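import Summits.QuantumFields.BalabanUV.T4Continuum.Spine.NE1p.DressedTerminalWitnessReuse

/-!
# T⁴ programme, spine estimate NE1′ (node O3b/H2) — A DIFFUSE FLUCTUATION MEASURE WITH A SMALL-FIELD INDICATOR BASE, part 1 of 3:
# the uniform law on a segment of `Fld 4 ℂ`, the tilted calculus on the small-field window, and the dressed operation against it IN
# CLOSED FORM — on row W7's tower `towerM` UNCHANGED (crew `b2b-balaban-t4-ne1p-formalise-*`, leaf seat 07, generation 7; witness row
# W16 = node N29q, BOOKED typer R-T65 (i), CLAIMS.log l.12283; LOCATED NOTE + INTENT l.12192; census slots (γ) «diffuse μ» AND (β)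
# «non-constant base» — leaf-08-g2's OFFER l.12241 (4) TAKEN)

Cell `pub-balaban`, sub-cell `t4`, BINDER-OWNERS row NE1′ (owner lineage t4-ne1p-p1; root `Spine/NE1p/DressedRoot.lean` p211416, ROOT-C of
record `DressedStabilityStrict` in `Spine/NE1p/DressedRootStrict.lean` p216910).  ADDITIVE — imports leaf-02-g4's row W11r part 1
`Spine/NE1p/DressedTerminalWitnessReuse` (p216180; through it S3l `DressedStabilityOfCanonicalSliceWinSchedules` p215128, W7
`DressedTowerWitnessSlice{,End}` p214450 ∕ p214558 (`towerM`, `Wm`, `aM`, `dfW`, `xM`, `𝒬M`, `cM`), W5 `DressedTowerWitness{,End}` p213903 ∕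
p214143 (`LW`, `atomW`, `defW`, `flAt`, `zeroExp`) and the Literature frame `T4TrajectoryDensity` (`wOp`, `expWeight`, `BddClass`,
`RealBaseAt`, `ExponentSliceAt`, `fldDir`) ∕ `T4TrajectoryModulus` (`bondBall`) ∕ `T4BlockTransport` (`Fld`, `latMove`, `latN`)) ONLY;
modifies nothing.  Part 2 = `Spine/NE1p/DressedTowerWitnessDiffuseBinders.lean` (the measure-class binders GENUINELY + the booking
convention + the separation); part 3 = `Spine/NE1p/DressedTowerWitnessDiffuseEnd.lean` (S3l's With-form BY NAME at every integer
`81 ≤ Lb ≤ 120`, ROOT-C of record, ROOT-B, the decided `Lb = 100`).  Three files ≤ 400 l. (declared deviation from «two», W13∕W15 pattern).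

WHY (LOCATED NOTE l.12192; leaf-01-g5's SATURATION CENSUS F5∕F6 = slots (β)∕(γ), adopted by R-T65 (i)).  In EVERY function-level END
instantiation of the crew (rows W1 … W15) the fluctuation measure is a TWO-ATOM sum of Dirac masses (`flAt a = δ_0 + δ_a`, W5
`DressedTowerWitness.lean` l.149) and the base density is the CONSTANT `base₁ ≡ 1`; FOR SUCH A MEASURE W5 itself proves `integrable_flAt`
(l.165), `aesm_flAt` (l.170) and `mem_bddClass_flAt` (l.187) FOR EVERY FUNCTION.  Hence the MEASURE-CLASS binders of the canonical terminal
face S3l — `h𝒢` (l.215–218: the translates `z ↦ Fn … (U + z)` lie in `BddClass ℂ μ`), `hmeas` (l.237–238), the three clauses of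
`hB : RealBaseAt` (l.219–222: `0 ≤ᵐ base`, `0 < μ (support base)`, integrability of the base density), the measurability clause of
`hE : ExponentSliceAt` (l.223–227), and the a.e. clauses of `hDμ` (l.229) ∕ `hpairx` (l.231–235) — are inhabited VACUOUSLY by all fifteen
witnesses.  On Bałaban's side the fluctuation integrals ([Balaban1989LargeFieldII] (1.71)∕(1.75) pp. 379–380 — TYPE ∕ CONTEXT, nothing
asserted) are against absolutely continuous laws carrying small-field characteristic functions `χ`, where these clauses are the
honest-integral guard of §L (`T4TrajectoryModulus.setIntegral_not_subtractive`).  THIS ROW supplies ONE inhabitant in which the guard BITES.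

THE DATA OF THIS PART (W7's booking `BM K`, trajectory `TM K`, amplitudes `aM K`, exponent `𝒬M`, couplings `xM` UNCHANGED):
* §1 THE SEGMENT LAW on `Fld 4 ℂ`: `seg a t := (t : ℂ) • a`, `segMeasure a := map (seg a) (Lebesgue on [−1, 1])` (finite);
  `measurableSet_bondBall` (countable intersection of measurable cylinders), `ae_mem_bondBall` (`‖a‖_∞ ≤ ρ` ⟹ a.e. `z ∈ bondBall ρ`, by
  `ae_map_iff`), `integral_segMeasure` (`integral_map`); NON-ATOMICITY (`segMeasure_singleton`, `μD_singleton`) is part 2 §4.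
* §2 THE TILT on the SMALL-FIELD WINDOW `[−1, ½]` of the parameter line: `Zden x = ∫ e^{−xt} dt > 0`, `Znum x = ∫ t e^{−xt} dt`, the tilted
  mean `mTilt x ∈ [−1, 1]` (no closed form used), complexified set-integral forms, linearity for affine integrands, and the CUT
  `setIntegral_indicator_half`: `∫_{[−1,1]} 𝟙{t ≤ ½}·g = ∫_{[−1,½]} g` (`setIntegral_indicator`).
* §3 THE DATUM: `μD k := segMeasure (atomW (k+1))` — uniform on `[−z_k, z_k]`, `z_k ≡ δf_k = ψ^{k+1}∕4`; the
  SMALL-FIELD INDICATOR BASE `baseD k z := 𝟙{Re z₀₀ ≤ ½·δf_k}` (non-constant, measurable, `{0,1}`-valued; pulled back: `𝟙{t ≤ ½}`); the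
  dressing `shiftD (k+1) = shiftD k + δf_k·mTilt x_k` (`x_k = ¼ a_K δf_k`, W7's `xM`); the carried functionals `FnD K 0 k U = a_K·(U₀₀ +
  shiftD k)` (W7's affine shape); the weight pulled back along the segment is `𝟙{t ≤ ½}·e^{−x_k t}` (`expWeight_seg`), MEASURABLE and
  INTEGRABLE against `μD k` with integral `Zden x_k ≠ 0` — the good set of `wOp` met by an honest integral —, and **`FnD_succ`**: `hFn` AS
  AN EQUATION: `wOp (expWeight (baseD k) (zeroExp + 𝒬M K k)) (μD k) 0` of the translates IS the tilted average over the small-field window,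
  in closed form `a_K·(U₀₀ + shiftD k + δf_k·mTilt x_k)`.

DECLARED TRIVIAL (as in W7∕W11r; live elsewhere): `𝒜 ≡ 0`, `s ≡ 0` (W9∕W12), `creg ≡ 0` (W10), `Sabs ≡ ∅` (W13), `rel := Eq` (W15 carries
the live gauge quotient), `ref = id`, one family at the zero block (`v = 1`; slot (δ) = W17), `q ≡ 0`, `z₁ = 0`; the `wOp` fallback point
`z₀ := z_k ≠ 0` rides (census variation (α) — IMMATERIAL on the good set, recorded not claimed).  WHAT IT IS NOT
(k2∕k3).  A DECIDED TOY: a one-dimensional uniform law on a segment of the bond-field space cut by a half-space indicator — NOT Bałaban's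
Gaussian × small-field fluctuation measure; `Lb` is the toy's integer, NOT Bałaban's `L` (no numeral from print); not an estimate; no
commutation identity; F-6's rate stays a displayed wall (`t4/CITED-FACTS-T4.md` §2∕§4); nothing of Bałaban's densities, gauges or
propagators is modelled or asserted; no `def … : Prop`; [folklore] toy kernel mathematics (Mathlib: `Measure.map`, `integral_map`,
`ae_map_iff`, `setIntegral_indicator`, interval integrals), 0 sorry, 0 citations used as facts.  Headline (c4): «the measure-class
binders bite: `BddClass` membership, `hmeas`, `RealBaseAt`'s three clauses, `hDμ` and `hpairx` a.e. discharged against a NON-ATOMIC law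
with a NON-CONSTANT base by measurability + `ae_map_iff`; `hFn` an honest tilted Bochner average in closed form; the canonical terminal
face fires at integer `Lb`; nothing of Bałaban's densities; NE1′ NOT proved».

HONEST FRAMING.  Rung (B)+1 bookkeeping on ONE finite four-torus of fixed physical size — NOT infinite volume, NOT a mass gap, NOT OS on
ℝ⁴, NOT the Clay problem, NOT summit progress.  NE1′ is NOT PRINTED and NOT PROVED; every headline reads «NE1′ ⇐ the named binders»;
spine PROVED 0∕9 unchanged.  HONEST DEPENDENCY: continuum YM on T⁴ ⇐ BetaPertH ∧ nine spine estimates (0/9 proved); BetaPertH ⇐ (D1) ∧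
(D4) ∧ CAP+tail; G-an2-4 gates asym, D1 and NE2/3/4.
-/


noncomputable section

namespace Summit.QuantumFields.BalabanUV.T4Continuum.NE1p.DressedTowerWitnessDiffuse

open MeasureTheory Set Metric Filter Finset intervalIntegral
open scoped BigOperators
open Literature.MathematicalPhysics.QuantumFieldTheory.Balaban1983to89
open Literature.MathematicalPhysics.QuantumFieldTheory.Balaban1983to89.T4TermFormat
open Literature.MathematicalPhysics.QuantumFieldTheory.Balaban1983to89.T4TermFormat.Booking
open T4TrajectoryModulus (bondBall)
open T4BlockTransport (Fld NDir latMove latN Site norm_dir_le)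
open T4BirthChartTransport (GaugeInvariant BirthSlice RelGauge)
open T4TrajectoryDensity
open Summit.QuantumFields.BalabanUV.T4Continuum.T4TrajectoryDensityDressed
open Summit.QuantumFields.BalabanUV.T4Continuum.T4TrajectoryDensityWitness
open Summit.QuantumFields.BalabanUV.T4Continuum.NE1p.DressedTowerWitness
open Summit.QuantumFields.BalabanUV.T4Continuum.NE1p.DressedTowerWitnessSlice
open Summit.QuantumFields.BalabanUV.T4Continuum.NE1p.DressedTerminalWitnessReuse

/-! ## §1 The uniform law on a segment of `Fld 4 ℂ` [folklore] -/

/-- THE SEGMENT MAP: `t ↦ t • a` from the real parameter line into the bond-field space. [folklore] -/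
def seg (a : Fld 4 ℂ) (t : ℝ) : Fld 4 ℂ := (t : ℂ) • a

/-- [folklore] -/ @[simp] theorem seg_apply (a : Fld 4 ℂ) (t : ℝ) (x : Site 4) (ν : Fin 4) : seg a t x ν = (t : ℂ) * a x ν := rfl

/-- [folklore] The segment map is measurable into the product σ-algebra (coordinatewise continuous). -/
theorem measurable_seg (a : Fld 4 ℂ) : Measurable (seg a) := by
  refine measurable_pi_iff.mpr fun x => measurable_pi_iff.mpr fun ν => ?_
  show Measurable fun t : ℝ => ((t : ℂ) • a) x ν
  simp only [Pi.smul_apply, smul_eq_mul]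
  exact (Complex.continuous_ofReal.mul continuous_const).measurable

/-- **THE SEGMENT LAW**: the push-forward of Lebesgue measure on `[−1, 1]` along `t ↦ t • a` — the UNIFORM law on the segment
`[−a, a]` of the bond-field space (total mass `2`). [folklore] -/
def segMeasure (a : Fld 4 ℂ) : Measure (Fld 4 ℂ) := Measure.map (seg a) (volume.restrict (Icc (-1 : ℝ) 1))

/-- [folklore] The segment law is finite. -/
instance isFiniteMeasure_segMeasure (a : Fld 4 ℂ) : IsFiniteMeasure (segMeasure a) := by
  unfold segMeasure; infer_instance

/-- [folklore] Evaluation at a bond is measurable. -/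
theorem measurable_eval (x : Site 4) (ν : Fin 4) : Measurable fun z : Fld 4 ℂ => z x ν :=
  (measurable_pi_apply ν).comp (measurable_pi_apply x)

/-- [folklore] W5's bond reading `U₀₀` is measurable. -/
theorem measurable_ev₀₀ : Measurable (ev₀₀ : Fld 4 ℂ → ℂ) := measurable_eval 0 0

/-- [folklore] **The fluctuation ball is a measurable set** — a countable intersection of measurable cylinders. -/
theorem measurableSet_bondBall (ρ : ℝ) : MeasurableSet (bondBall 4 ρ : Set (Fld 4 ℂ)) := by
  have : (bondBall 4 ρ : Set (Fld 4 ℂ)) = ⋂ x : Site 4, ⋂ ν : Fin 4, {z | ‖z x ν‖ ≤ ρ} := by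
    ext z; simp [bondBall]
  rw [this]
  exact MeasurableSet.iInter fun x => MeasurableSet.iInter fun ν =>
    measurableSet_le (measurable_eval x ν).norm measurable_const

/-- [folklore] **A.e. support through `ae_map_iff`**: if `‖a‖_∞ ≤ ρ` then `segMeasure a`-a.e. `z ∈ bondBall ρ`. -/
theorem ae_mem_bondBall {a : Fld 4 ℂ} {ρ : ℝ} (ha : ∀ x ν, ‖a x ν‖ ≤ ρ) :
    ∀ᵐ z ∂segMeasure a, z ∈ (bondBall 4 ρ : Set (Fld 4 ℂ)) := by
  unfold segMeasure
  refine (ae_map_iff (measurable_seg a).aemeasurable (p := fun z => z ∈ (bondBall 4 ρ : Set (Fld 4 ℂ)))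
    (measurableSet_bondBall ρ)).mpr ?_
  filter_upwards [ae_restrict_mem measurableSet_Icc] with t ht
  intro x ν
  simp only [seg, Pi.smul_apply, smul_eq_mul, norm_mul, Complex.norm_real, Real.norm_eq_abs]
  have : |t| ≤ 1 := abs_le.mpr ht
  calc |t| * ‖a x ν‖ ≤ 1 * ‖a x ν‖ := by gcongr
    _ = ‖a x ν‖ := one_mul _
    _ ≤ ρ := ha x ν

/-- [folklore] **Integration against the segment law** = integration over `[−1, 1]` of the pulled-back function (`integral_map`). -/
theorem integral_segMeasure {E : Type*} [NormedAddCommGroup E] [NormedSpace ℝ E] [CompleteSpace E]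
    (a : Fld 4 ℂ) {f : Fld 4 ℂ → E} (hf : AEStronglyMeasurable f (segMeasure a)) :
    ∫ z, f z ∂segMeasure a = ∫ t in Icc (-1 : ℝ) 1, f (seg a t) := by
  unfold segMeasure at hf ⊢
  rw [integral_map (measurable_seg a).aemeasurable hf]

/-! ## §2 The tilted law on the SMALL-FIELD WINDOW `[−1, ½]` of the parameter line: partition function, first moment, tilted mean [folklore] -/

/-- THE PARTITION FUNCTION of the tilt `e^{−xt}` on the window `[−1, ½]` (the segment `[−1, 1]` cut by the small-field indicator
`t ≤ ½`, §3). [folklore] -/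
def Zden (x : ℝ) : ℝ := ∫ t in (-1 : ℝ)..(1 / 2), Real.exp (-(x * t))

/-- THE FIRST MOMENT of the tilt on the window. [folklore] -/
def Znum (x : ℝ) : ℝ := ∫ t in (-1 : ℝ)..(1 / 2), t * Real.exp (-(x * t))

/-- THE TILTED MEAN `Znum x ∕ Zden x` (a truncated Langevin mean — CONTEXT; no closed form is used). [folklore] -/
def mTilt (x : ℝ) : ℝ := Znum x / Zden x

/-- [folklore] -/ theorem continuous_tilt (x : ℝ) : Continuous fun t : ℝ => Real.exp (-(x * t)) := by fun_prop
/-- [folklore] -/ theorem continuous_ttilt (x : ℝ) : Continuous fun t : ℝ => t * Real.exp (-(x * t)) := by fun_prop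

/-- [folklore] The partition function is POSITIVE (a positive continuous density on a non-degenerate interval). -/
theorem Zden_pos (x : ℝ) : 0 < Zden x :=
  intervalIntegral_pos_of_pos_on ((continuous_tilt x).intervalIntegrable _ _) (fun t _ => Real.exp_pos _) (by norm_num)

/-- [folklore] `|Znum x| ≤ Zden x` (`|t| ≤ 1` on the window). -/
theorem abs_Znum_le (x : ℝ) : |Znum x| ≤ Zden x := by
  unfold Znum Zden
  have hle : (-1 : ℝ) ≤ 1 / 2 := by norm_num
  calc |∫ t in (-1 : ℝ)..(1 / 2), t * Real.exp (-(x * t))|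
      ≤ ∫ t in (-1 : ℝ)..(1 / 2), |t * Real.exp (-(x * t))| := abs_integral_le_integral_abs hle
    _ ≤ ∫ t in (-1 : ℝ)..(1 / 2), Real.exp (-(x * t)) := by
        refine integral_mono_on hle ((continuous_ttilt x).abs.intervalIntegrable _ _)
          ((continuous_tilt x).intervalIntegrable _ _) fun t ht => ?_
        rw [abs_mul, abs_of_pos (Real.exp_pos _)]
        have : |t| ≤ 1 := abs_le.mpr ⟨ht.1, by linarith [ht.2]⟩
        calc |t| * Real.exp (-(x * t)) ≤ 1 * Real.exp (-(x * t)) := by gcongr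
          _ = Real.exp (-(x * t)) := one_mul _

/-- [folklore] **The tilted mean lies in `[−1, 1]`.** -/
theorem abs_mTilt_le (x : ℝ) : |mTilt x| ≤ 1 := by
  unfold mTilt
  rw [abs_div, abs_of_pos (Zden_pos x), div_le_one (Zden_pos x)]
  exact abs_Znum_le x

/-- [folklore] The complexified partition function as the set integral over `Icc` that `integral_map` produces. -/
theorem setIntegral_tilt (x : ℝ) : ∫ t in Icc (-1 : ℝ) (1 / 2), Complex.exp (-((x : ℂ) * (t : ℂ))) = (Zden x : ℂ) := by
  have hfun : (fun t : ℝ => Complex.exp (-((x : ℂ) * (t : ℂ)))) = fun t : ℝ => ((Real.exp (-(x * t)) : ℝ) : ℂ) := by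
    funext t; push_cast; rfl
  rw [hfun, integral_Icc_eq_integral_Ioc, ← intervalIntegral.integral_of_le (by norm_num : (-1 : ℝ) ≤ 1 / 2),
    intervalIntegral.integral_ofReal]
  rfl

/-- [folklore] The complexified first moment likewise. -/
theorem setIntegral_ttilt (x : ℝ) :
    ∫ t in Icc (-1 : ℝ) (1 / 2), (t : ℂ) * Complex.exp (-((x : ℂ) * (t : ℂ))) = (Znum x : ℂ) := by
  have hfun : (fun t : ℝ => (t : ℂ) * Complex.exp (-((x : ℂ) * (t : ℂ)))) =
      fun t : ℝ => ((t * Real.exp (-(x * t)) : ℝ) : ℂ) := by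
    funext t; push_cast; rfl
  rw [hfun, integral_Icc_eq_integral_Ioc, ← intervalIntegral.integral_of_le (by norm_num : (-1 : ℝ) ≤ 1 / 2),
    intervalIntegral.integral_ofReal]
  rfl

/-- [folklore] **Linearity**: the tilted integral of an affine function of the parameter over the window. -/
theorem setIntegral_affine_tilt (x : ℝ) (A B : ℂ) :
    ∫ t in Icc (-1 : ℝ) (1 / 2), Complex.exp (-((x : ℂ) * (t : ℂ))) * (A + B * (t : ℂ)) = A * (Zden x : ℂ) + B * (Znum x : ℂ) := by
  have h1 : IntegrableOn (fun t : ℝ => Complex.exp (-((x : ℂ) * (t : ℂ)))) (Icc (-1 : ℝ) (1 / 2)) :=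
    (by fun_prop : Continuous fun t : ℝ => Complex.exp (-((x : ℂ) * (t : ℂ)))).integrableOn_Icc
  have h2 : IntegrableOn (fun t : ℝ => (t : ℂ) * Complex.exp (-((x : ℂ) * (t : ℂ)))) (Icc (-1 : ℝ) (1 / 2)) :=
    (by fun_prop : Continuous fun t : ℝ => (t : ℂ) * Complex.exp (-((x : ℂ) * (t : ℂ)))).integrableOn_Icc
  have hsplit : (fun t : ℝ => Complex.exp (-((x : ℂ) * (t : ℂ))) * (A + B * (t : ℂ))) =
      fun t : ℝ => A * Complex.exp (-((x : ℂ) * (t : ℂ))) + B * ((t : ℂ) * Complex.exp (-((x : ℂ) * (t : ℂ)))) := by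
    funext t; ring
  rw [hsplit, integral_add (h1.const_mul A) (h2.const_mul B), MeasureTheory.integral_const_mul,
    MeasureTheory.integral_const_mul, setIntegral_tilt, setIntegral_ttilt]

/-- [folklore] **Cutting the segment by the indicator**: integrating `𝟙_{t ≤ ½}·g` over `[−1, 1]` is integrating `g` over `[−1, ½]`
(`setIntegral_indicator` on the measurable half-line). -/
theorem setIntegral_indicator_half (g : ℝ → ℂ) :
    ∫ t in Icc (-1 : ℝ) 1, ((Set.indicator (Iic (1 / 2 : ℝ)) (fun _ => (1 : ℝ)) t : ℝ) : ℂ) * g t =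
      ∫ t in Icc (-1 : ℝ) (1 / 2), g t := by
  have hfun : (fun t : ℝ => ((Set.indicator (Iic (1 / 2 : ℝ)) (fun _ => (1 : ℝ)) t : ℝ) : ℂ) * g t) =
      Set.indicator (Iic (1 / 2 : ℝ)) g := by
    funext t
    by_cases ht : t ∈ Iic (1 / 2 : ℝ)
    · rw [Set.indicator_of_mem ht, Set.indicator_of_mem ht]; simp
    · rw [Set.indicator_of_notMem ht, Set.indicator_of_notMem ht]; simp
  have hset : Icc (-1 : ℝ) 1 ∩ Iic (1 / 2 : ℝ) = Icc (-1 : ℝ) (1 / 2) := by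
    ext t
    simp only [mem_inter_iff, Set.mem_Icc, Set.mem_Iic]
    constructor
    · rintro ⟨⟨h1, _⟩, h3⟩; exact ⟨h1, h3⟩
    · rintro ⟨h1, h3⟩; exact ⟨⟨h1, by linarith⟩, h3⟩
  rw [hfun, setIntegral_indicator measurableSet_Iic, hset]

/-! ## §3 The datum: the law at every step with a SMALL-FIELD INDICATOR base, the dressing, the carried functionals, `hFn` AS AN EQUATION [decided toy] -/

/-- **THE DIFFUSE FLUCTUATION LAW AT STEP `k`** [decided toy]: uniform on the segment `[−z_k, z_k]`, `z_k = atomW (k+1) ≡ δf_k`. -/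
def μD (k : ℕ) : Measure (Fld 4 ℂ) := segMeasure (atomW (k + 1))

/-- [folklore] -/ instance isFiniteMeasure_μD (k : ℕ) : IsFiniteMeasure (μD k) := by unfold μD; infer_instance


/-- [folklore] The reading along the segment. -/
theorem ev₀₀_seg (a : Fld 4 ℂ) (t : ℝ) : ev₀₀ (seg a t) = (t : ℂ) * ev₀₀ a := rfl

/-- [folklore] The reading along the step's segment: `(t • z_k)₀₀ = t·δf_k` (W5's `ev₀₀_atomW` by name). -/
theorem ev₀₀_seg_atomW (k : ℕ) (t : ℝ) : ev₀₀ (seg (atomW (k + 1)) t) = ((t * dfW k : ℝ) : ℂ) := by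
  rw [ev₀₀_seg, ev₀₀_atomW]; unfold dfW; push_cast; ring

/-- **THE SMALL-FIELD INDICATOR BASE AT STEP `k`** [decided toy]: `base_k z := 𝟙{Re z₀₀ ≤ ½·δf_k}` — a NON-CONSTANT, `{0,1}`-valued base
density (census slot (β); reading: a small-field CHARACTERISTIC FUNCTION, [Balaban1989LargeFieldII] (1.71)'s `χ` — TYPE ∕ CONTEXT only,
nothing asserted).  On the segment it cuts the parameter window to `[−1, ½]`. [folklore] -/
def baseD (k : ℕ) : Fld 4 ℂ → ℝ := Set.indicator {z : Fld 4 ℂ | (ev₀₀ z).re ≤ dfW k / 2} fun _ => 1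

/-- [folklore] The small-field set is measurable (a closed half-space in the measurable reading `Re U₀₀`). -/
theorem measurableSet_smallField (k : ℕ) : MeasurableSet {z : Fld 4 ℂ | (ev₀₀ z).re ≤ dfW k / 2} :=
  measurableSet_le (Complex.measurable_re.comp measurable_ev₀₀) measurable_const

/-- [folklore] The base is measurable. -/
theorem measurable_baseD (k : ℕ) : Measurable (baseD k) :=
  (measurable_const.indicator (measurableSet_smallField k))

/-- [folklore] `0 ≤ base_k ≤ 1`. -/
theorem baseD_nonneg (k : ℕ) (z : Fld 4 ℂ) : 0 ≤ baseD k z := by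
  unfold baseD; exact Set.indicator_nonneg (fun _ _ => zero_le_one) z

/-- [folklore] -/
theorem baseD_le_one (k : ℕ) (z : Fld 4 ℂ) : baseD k z ≤ 1 := by
  unfold baseD; exact Set.indicator_le_self' (fun _ _ => zero_le_one) z

/-- [folklore] **The base pulled back along the segment is the half-line indicator `𝟙{t ≤ ½}`.** -/
theorem baseD_seg (k : ℕ) (t : ℝ) : baseD k (seg (atomW (k + 1)) t) = Set.indicator (Iic (1 / 2 : ℝ)) (fun _ => (1 : ℝ)) t := by
  have hmem : seg (atomW (k + 1)) t ∈ {z : Fld 4 ℂ | (ev₀₀ z).re ≤ dfW k / 2} ↔ t ∈ Iic (1 / 2 : ℝ) := by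
    simp only [mem_setOf_eq, ev₀₀_seg_atomW, Complex.ofReal_re, Set.mem_Iic]
    have hd := dfW_pos k
    constructor
    · intro h
      by_contra hlt
      have hlt' : 1 / 2 < t := not_le.mp hlt
      nlinarith
    · intro h
      nlinarith
  unfold baseD
  by_cases ht : t ∈ Iic (1 / 2 : ℝ)
  · rw [Set.indicator_of_mem (hmem.mpr ht), Set.indicator_of_mem ht]
  · rw [Set.indicator_of_notMem (fun h => ht (hmem.mp h)), Set.indicator_of_notMem ht]

/-- THE ACCUMULATED DRESSING under the diffuse law [decided toy]: `shiftD 0 = 0`, `shiftD (k+1) = shiftD k + δf_k·mTilt x_k`. [folklore] -/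
def shiftD (K : ℕ) : ℕ → ℝ
  | 0 => 0
  | k + 1 => shiftD K k + dfW k * mTilt (xM K k)

/-- THE CARRIED FUNCTIONALS at cutoff `K` [decided toy]: generation `0` at scale `k` is `a_K·(U₀₀ + shiftD k)` (W7's affine shape,
diffuse dressing); later generations `0`. [folklore] -/
def FnD (K : ℕ) (k' k : ℕ) (U : Fld 4 ℂ) : ℂ := if k' = 0 then (aM K : ℂ) * (ev₀₀ U + (shiftD K k : ℂ)) else 0

/-- [folklore] **The weight pulled back along the segment is the CUT tilt `𝟙{t ≤ ½}·e^{−x_k t}`** (W7's coupling `x_k = ¼ a_K δf_k`). -/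
theorem expWeight_seg (K k : ℕ) (U : Fld 4 ℂ) (t : ℝ) :
    expWeight (baseD k) (zeroExp + 𝒬M K k) U (seg (atomW (k + 1)) t) =
      ((Set.indicator (Iic (1 / 2 : ℝ)) (fun _ => (1 : ℝ)) t : ℝ) : ℂ) * Complex.exp (-((xM K k : ℂ) * (t : ℂ))) := by
  rw [expWeight_apply, baseD_seg]
  simp only [zeroExp, 𝒬M, Pi.add_apply, zero_add, ev₀₀_seg_atomW, xM]
  congr 2; push_cast; ring

/-- [folklore] **The weight is MEASURABLE** in the product σ-algebra (indicator of a measurable set times a continuous function of the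
measurable reading `U₀₀`). -/
theorem measurable_expWeightD (K k : ℕ) (U : Fld 4 ℂ) : Measurable (expWeight (baseD k) (zeroExp + 𝒬M K k) U) := by
  have : expWeight (baseD k) (zeroExp + 𝒬M K k) U =
      fun z => ((baseD k z : ℝ) : ℂ) * Complex.exp (-((0 : ℂ) + ((1 / 4 : ℝ) : ℂ) * (aM K : ℂ) * ev₀₀ z)) := by
    funext z; simp [expWeight_apply, zeroExp, 𝒬M]
  rw [this]
  have hev := measurable_ev₀₀
  have hb : Measurable fun z : Fld 4 ℂ => ((baseD k z : ℝ) : ℂ) := Complex.measurable_ofReal.comp (measurable_baseD k)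
  fun_prop

/-- [folklore] **The translates of the carried functionals are MEASURABLE.** -/
theorem measurable_FnD_translate (K k' k : ℕ) (U : Fld 4 ℂ) : Measurable fun z : Fld 4 ℂ => FnD K k' k (U + z) := by
  unfold FnD
  have hev := measurable_ev₀₀
  by_cases h : k' = 0
  · simp only [h, ↓reduceIte, ev₀₀_add]; fun_prop
  · simp only [h, ↓reduceIte]; exact measurable_const

/-- [folklore] **The weight is INTEGRABLE against the diffuse law** (bounded measurable pull-back on a compact interval,
`integrable_map_measure`). -/
theorem integrable_weight_μD (K k : ℕ) (U : Fld 4 ℂ) : Integrable (expWeight (baseD k) (zeroExp + 𝒬M K k) U) (μD k) := by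
  unfold μD segMeasure
  rw [integrable_map_measure (measurable_expWeightD K k U).aestronglyMeasurable (measurable_seg _).aemeasurable]
  have hcomp : expWeight (baseD k) (zeroExp + 𝒬M K k) U ∘ seg (atomW (k + 1)) =
      fun t : ℝ => ((Set.indicator (Iic (1 / 2 : ℝ)) (fun _ => (1 : ℝ)) t : ℝ) : ℂ) * Complex.exp (-((xM K k : ℂ) * (t : ℂ))) := by
    funext t; exact expWeight_seg K k U t
  rw [hcomp]
  have hc : IntegrableOn (fun t : ℝ => Complex.exp (-((xM K k : ℂ) * (t : ℂ)))) (Icc (-1 : ℝ) 1) :=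
    (by fun_prop : Continuous fun t : ℝ => Complex.exp (-((xM K k : ℂ) * (t : ℂ)))).integrableOn_Icc
  refine Integrable.mono' (hc.norm) ?_ (Eventually.of_forall fun t => ?_)
  · exact ((Complex.measurable_ofReal.comp (measurable_const.indicator measurableSet_Iic)).mul
      (by fun_prop : Measurable fun t : ℝ => Complex.exp (-((xM K k : ℂ) * (t : ℂ))))).aestronglyMeasurable
  · rw [norm_mul, Complex.norm_real, Real.norm_eq_abs]
    have h01 : |Set.indicator (Iic (1 / 2 : ℝ)) (fun _ => (1 : ℝ)) t| ≤ 1 := by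
      rw [abs_of_nonneg (Set.indicator_nonneg (fun _ _ => zero_le_one) t)]
      exact Set.indicator_le_self' (fun _ _ => zero_le_one) t
    calc |Set.indicator (Iic (1 / 2 : ℝ)) (fun _ => (1 : ℝ)) t| * ‖Complex.exp (-((xM K k : ℂ) * (t : ℂ)))‖
        ≤ 1 * ‖Complex.exp (-((xM K k : ℂ) * (t : ℂ)))‖ := by gcongr
      _ = ‖Complex.exp (-((xM K k : ℂ) * (t : ℂ)))‖ := one_mul _

/-- [folklore] **The partition function of the diffuse law** is `Zden x_k` — in particular NON-ZERO: the good set of `wOp` is met. -/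
theorem integral_weight_μD (K k : ℕ) (U : Fld 4 ℂ) :
    ∫ z, expWeight (baseD k) (zeroExp + 𝒬M K k) U z ∂μD k = (Zden (xM K k) : ℂ) := by
  unfold μD
  rw [integral_segMeasure _ (measurable_expWeightD K k U).aestronglyMeasurable]
  simp only [expWeight_seg]
  rw [setIntegral_indicator_half]
  exact setIntegral_tilt _

/-- [folklore] The weighted integral of the translated affine functional: `A·Zden + B·Znum`. -/
theorem integral_weight_FnD (K k : ℕ) (U : Fld 4 ℂ) :
    ∫ z, expWeight (baseD k) (zeroExp + 𝒬M K k) U z • FnD K 0 k (U + z) ∂μD k =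
      (aM K : ℂ) * (ev₀₀ U + (shiftD K k : ℂ)) * (Zden (xM K k) : ℂ) + (aM K : ℂ) * ((dfW k : ℝ) : ℂ) * (Znum (xM K k) : ℂ) := by
  unfold μD
  have hsm : AEStronglyMeasurable (fun z => expWeight (baseD k) (zeroExp + 𝒬M K k) U z • FnD K 0 k (U + z))
      (segMeasure (atomW (k + 1))) := by
    have h1 := measurable_expWeightD K k U
    have h2 := measurable_FnD_translate K 0 k U
    simp only [smul_eq_mul]
    first
      | exact (h1.mul' h2).aestronglyMeasurable
      | exact (h1.mul h2).aestronglyMeasurable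
  rw [integral_segMeasure _ hsm]
  simp only [expWeight_seg, FnD, ↓reduceIte, ev₀₀_add, ev₀₀_seg_atomW, smul_eq_mul, mul_assoc]
  rw [setIntegral_indicator_half]
  have : (fun t : ℝ => Complex.exp (-((xM K k : ℂ) * (t : ℂ))) *
      ((aM K : ℂ) * (ev₀₀ U + ((t * dfW k : ℝ) : ℂ) + (shiftD K k : ℂ)))) =
      fun t : ℝ => Complex.exp (-((xM K k : ℂ) * (t : ℂ))) *
        ((aM K : ℂ) * (ev₀₀ U + (shiftD K k : ℂ)) + ((aM K : ℂ) * ((dfW k : ℝ) : ℂ)) * (t : ℂ)) := by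
    funext t; push_cast; ring
  rw [this, setIntegral_affine_tilt]
  ring

/-- **`hFn` AS AN EQUATION — THE DRESSED OPERATION AGAINST THE DIFFUSE LAW IN CLOSED FORM** [folklore]: the step `k → k+1` of the
carried functional IS the normalised tilted Bochner average `wOp (expWeight (baseD k) (zeroExp + 𝒬M K k)) (μD k) z₀` of its translates
over the small-field window — `a_K·(U₀₀ + shiftD k + δf_k·mTilt x_k)` — for EVERY fallback point `z₀` (the good set of `wOp` holds, so
`z₀` is immaterial: census variation (α) rides here, declared immaterial). -/
theorem FnD_succ (K k' k : ℕ) (z₀ U : Fld 4 ℂ) :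
    FnD K k' (k + 1) U = wOp (expWeight (baseD k) (zeroExp + 𝒬M K k)) (μD k) z₀ U (fun z => FnD K k' k (U + z)) := by
  have hZ : (Zden (xM K k) : ℂ) ≠ 0 := by exact_mod_cast (Zden_pos _).ne'
  have hne : (∫ z, expWeight (baseD k) (zeroExp + 𝒬M K k) U z ∂μD k) ≠ 0 := by rw [integral_weight_μD]; exact hZ
  rw [wOp_of_pos (integrable_weight_μD K k U) hne, integral_weight_μD]
  by_cases h : k' = 0
  · subst h
    rw [integral_weight_FnD]
    simp only [FnD, ↓reduceIte, shiftD, mTilt, smul_eq_mul]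
    push_cast
    field_simp
    ring
  · simp [FnD, h]

end Summit.QuantumFields.BalabanUV.T4Continuum.NE1p.DressedTowerWitnessDiffuse

end
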